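import Mathlib.LinearAlgebra.Matrix.BilinearForm
import Summits.HodgeConjecture.HodgeConjecture.Theorems.LinearSystemTorelliLocalTubeSpanThinRep
import Summits.HodgeConjecture.HodgeConjecture.Theorems.LinearSystemTorelliLocalTubeSpanThinDynamics
import Summits.HodgeConjecture.HodgeConjecture.Theorems.LinearSystemTorelliLocalTubeSpanThinClassification
import Summits.HodgeConjecture.HodgeConjecture.Theorems.LinearSystemTorelliLocalTubeSpanThinCocycle

/-!
# Route LinearSystemTorelli — crux `LocalTubeSpan`: the thin boundary of cyclic detection

Helper file (`--supports stmt-HodgeConjecture-2490`, line `Sketch`, cycle-3 composition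
`exists_thinConfiguration_not_injective`).  The crux ("local Schnell theorem", C. Schnell,
*Primitive cohomology and the tube mapping*, Math. Z. 268 (2010) §3, §7) is reduced by the line to
CYCLIC DETECTION: injectivity of Schnell's third map `H¹(G, V) → ∏_{g ∈ G} V/(g - 1)V` for a local
monodromy group `G` acting on `V = H^{2p-1}(X_s, ℚ)_van` by Picard–Lefschetz transvections
`T_δ(x) = x - B(x, δ)δ` along integral local vanishing cycles `δ`.  Schnell's Prop. 12 proves it
when the cycles form a skew-symmetric vanishing lattice (W. Janssen, Math. Ann. 266 (1983)); the
line proved it for the local configuration types 1–4 (NC-nodal, one complete orbit with radical,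
mixed, orthogonal clusters) and for connected clusters from finite data.  This file records the
BOUNDARY of the method — a negative result:

* `localTubeSpan_exists_thinConfiguration_not_injective` — there is a finitely generated group
  acting on a 2-dimensional `ℚ`-space through INTEGRAL symplectic transvections of a nondegenerate
  alternating form along three cycles `e_{t₁}, e_{t₂}, e_{t₃} = e_{t₁} + e_{t₂}` with
  `B(e_{t₁}, e_{t₂}) = 4`, whose third map is NOT injective.

The example (the free group on three letters acting on `ℚ²` by `T₁(v) = (v₀ + 4v₁, v₁)`,
`T₂(v) = (v₀, v₁ - 4v₀)`, `T₃(v) = v - 4(v₀ - v₁)(1,1)`; ping-pong on three cones makes the image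
thin: every element acts with `g - 1` invertible or is conjugate to a power of a generator, so the
cocycle `φ(x₁) = φ(x₂) = 0`, `φ(x₃) = (1,1)` is undetected by every element although it is not a
coboundary — a coboundary `dx` has exponents `-B(x, e_t)`, additive in the relation
`e_{t₃} = e_{t₁} + e_{t₂}`) is assembled from the four cycle-3 stub files `…ThinRep`,
`…ThinDynamics`, `…ThinClassification`, `…ThinCocycle`.  Consequence for the crux: LocalTubeSpan is
NOT a consequence of "the local monodromy acts by Picard–Lefschetz transvections along integral
vanishing cycles" — a linear relation among local vanishing cycles (a locally visible class) can go
undetected when the branches pair by `|⟨δ, δ'⟩| ≥ 3` and generate a thin group; every proof must use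
the Janssen-completeness (arithmeticity) of the local vanishing configuration, as Schnell's global
argument does through Janssen's Theorem 2.5.

References: [Schnell2010] C. Schnell, Primitive cohomology and the tube mapping, Math. Z. 268
(2010) §7 (Prop. 12; Example of a non-injective restriction map); the ping-pong lemma (folklore,
Lyndon–Schupp, Combinatorial Group Theory, III.12).
-/

-- `Summit.HodgeConjecture.HodgeConjecture.Theorems` is the mandated namespace (single-conjunct summit:
-- Sub = Summit), which `linter.dupNamespace` flags on every declaration; the lakefile turns the
-- linter off tree-wide (weak option), restated here so stand-alone elaboration is warning-free too.
set_option linter.dupNamespace false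

noncomputable section

open CategoryTheory groupCohomology
open Literature.AlgebraicGeometry.HodgeTheory

namespace Summit.HodgeConjecture.HodgeConjecture.Theorems

/-- **The thin boundary of cyclic detection.**  There is a finitely generated group `G` acting on a
2-dimensional `ℚ`-space `V` through integral symplectic transvections `x ↦ x - B(x, e_t) e_t` of a
nondegenerate alternating form `B` along three cycles with `e_{t₃} = e_{t₁} + e_{t₂}` and
`B(e_{t₁}, e_{t₂}) = 4`, such that Schnell's third map `H¹(G, V) → ∏_{g ∈ G} V/(g - 1)V` is not
injective.  (Contrast: for the cycles of a skew-symmetric vanishing lattice the map is injective,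
[Schnell2010] Prop. 12 = `localTubeSpan_injective_evalCoinv_of_vanishingLattice`.)
[cite: Schnell2010, §7 Prop. 12] -/
theorem localTubeSpan_exists_thinConfiguration_not_injective :
    ∃ (G : Type) (_ : Group G) (A : Rep ℚ G) (B : LinearMap.BilinForm ℚ A.V) (s : Set G)
      (e : G → A.V), B.Nondegenerate ∧ B.IsAlt ∧ s.Finite ∧ Subgroup.closure s = ⊤ ∧
      (∀ t ∈ s, ∀ x : A.V, A.ρ t x = x - B x (e t) • e t) ∧
      (∀ t ∈ s, ∀ t' ∈ s, ∃ n : ℤ, B (e t) (e t') = n) ∧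
      Module.finrank ℚ A.V = 2 ∧
      (∃ t₁ ∈ s, ∃ t₂ ∈ s, ∃ t₃ ∈ s, e t₃ = e t₁ + e t₂ ∧ B (e t₁) (e t₂) = 4) ∧
      ¬ Function.Injective (evalCoinv A) := by
  classical
  obtain ⟨ρ, h0, h1, h2⟩ := localTubeSpan_exists_thinRep
  -- the dichotomy for the free group, from the dynamics
  have hclass := localTubeSpan_thinClassification ρ FreeGroup.of (FreeGroup.closure_range_of _)
    (fun L hL0 hLc a b ha hb hab =>
      localTubeSpan_thinDynamics ρ FreeGroup.of h0 h1 h2 L hL0 hLc a b ha hb hab)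
  have hthin := localTubeSpan_not_injective_evalCoinv_thin ρ h0 h1 h2 hclass
  -- the data
  let d : Fin 3 → (Fin 2 → ℚ) := ![![1, 0], ![0, 1], ![1, 1]]
  have hd0 : d 0 = ![1, 0] := rfl
  have hd1 : d 1 = ![0, 1] := rfl
  have hd2 : d 2 = ![1, 1] := rfl
  let B : LinearMap.BilinForm ℚ (Fin 2 → ℚ) := Matrix.toBilin' !![(0 : ℚ), 4; -4, 0]
  have hBapply : ∀ x y : Fin 2 → ℚ, B x y = 4 * (x 0 * y 1 - x 1 * y 0) := fun x y => by
    change Matrix.toBilin' !![(0 : ℚ), 4; -4, 0] x y = _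
    rw [Matrix.toBilin'_apply']
    simp [Matrix.mulVec, dotProduct, Fin.sum_univ_two]
    ring
  let e : FreeGroup (Fin 3) → (Fin 2 → ℚ) := fun g =>
    if hg : ∃ i, FreeGroup.of i = g then d (Classical.choose hg) else 0
  have he : ∀ i, e (FreeGroup.of i) = d i := fun i => by
    have hg : ∃ j, FreeGroup.of j = FreeGroup.of i := ⟨i, rfl⟩
    change (if hg : ∃ j, FreeGroup.of j = FreeGroup.of i then d (Classical.choose hg) else 0) = d i
    rw [dif_pos hg, FreeGroup.of_injective (Classical.choose_spec hg)]
  refine ⟨FreeGroup (Fin 3), inferInstance, Rep.of ρ, B, Set.range FreeGroup.of, e, ?_, ?_,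
    Set.finite_range _, FreeGroup.closure_range_of _, ?_, ?_, Module.finrank_fin_fun ℚ, ?_, hthin⟩
  · -- nondegenerate: `det = 16`
    refine LinearMap.BilinForm.nondegenerate_toBilin'_iff_det_ne_zero.2 ?_
    rw [Matrix.det_fin_two_of]
    norm_num
  · -- alternating
    intro x
    rw [hBapply]
    ring
  · -- the generators act as the transvections along `d i`
    have key : ∀ (i : Fin 3) (x : Fin 2 → ℚ), ρ (FreeGroup.of i) x = x - B x (d i) • d i := by
      intro i x
      rw [hBapply]
      match i with
      | 0 => rw [h0, hd0]; ext j; fin_cases j <;> simp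
      | 1 => rw [h1, hd1]; ext j; fin_cases j <;> simp
      | 2 => rw [h2, hd2]; ext j; fin_cases j <;> simp
    rintro _ ⟨i, rfl⟩ x
    rw [he]
    exact key i x
  · -- integral pairings (`0, ±4`)
    have key : ∀ i j : Fin 3, ∃ n : ℤ, B (d i) (d j) = n := by
      intro i j
      rw [hBapply]
      match i, j with
      | 0, 0 => exact ⟨0, by norm_num [hd0]⟩
      | 0, 1 => exact ⟨4, by norm_num [hd0, hd1]⟩
      | 0, 2 => exact ⟨4, by norm_num [hd0, hd2]⟩
      | 1, 0 => exact ⟨-4, by norm_num [hd0, hd1]⟩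
      | 1, 1 => exact ⟨0, by norm_num [hd1]⟩
      | 1, 2 => exact ⟨-4, by norm_num [hd1, hd2]⟩
      | 2, 0 => exact ⟨-4, by norm_num [hd0, hd2]⟩
      | 2, 1 => exact ⟨4, by norm_num [hd1, hd2]⟩
      | 2, 2 => exact ⟨0, by norm_num [hd2]⟩
    rintro _ ⟨i, rfl⟩ _ ⟨j, rfl⟩
    rw [he, he]
    exact key i j
  · refine ⟨FreeGroup.of 0, ⟨0, rfl⟩, FreeGroup.of 1, ⟨1, rfl⟩, FreeGroup.of 2, ⟨2, rfl⟩, ?_, ?_⟩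
    · rw [he, he, he, hd0, hd1, hd2]; ext j; fin_cases j <;> simp
    · rw [he, he, hBapply, hd0, hd1]; norm_num

end Summit.HodgeConjecture.HodgeConjecture.Theorems

end
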